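import Mathlib
import Summits.NavierStokesRegularity.NavierStokesRegularity.Theorems.WakeRatchetTailRatchetDSSVisc
import HarnessLib

/-!
# `WakeRatchet.EternalViscousRate` (stmt-NavierStokesRegularity-25647) and its parent
# `WakeRatchet.TailRateRatchet` (stmt-NavierStokesRegularity-25584):
# negative lemmas modulo `ViscousBlockDSSWaves` (refuter analysis; no verdict changes)

THE POINT.  For a POSITIVE covariant viscosity `ν̂ > 0` the renormalised lattice
`W_n' = −W_n + Q(W_n) + Λ A(W_{n−1}) + Λ⁻¹ B(W_{n+1}, W_n) − ν̂ (1+ε₀)^{2n} e^{−σ} W_n`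
(`IsEternalVisc`) is covariant under the shift `(n, σ) ↦ (n + p, σ + T)` ONLY for the lag
`T = 2p·log(1+ε₀)`: the dissipation coefficient of shell `n + p` at log-time `σ` equals that of shell `n`
at `σ − T` iff `(1+ε₀)^{2p} = e^{T}`.  Hence (`viscBlockDSS_lag`) every NON-TRIVIAL block-self-similar
admissible eternal solution `W_{n+p}(σ) = W_n(σ − T)` with `ν̂ > 0` has its lag PINNED,
`e^{T} = ((1+ε₀)^2)^p`, and therefore its block energy ratio pinned to the a = 1 rate,
`ϱ = e^{2T} Λ^{−2p} = ((1+ε₀)⁻¹)^p` (`viscBlockDSS_ratio`).  The tree's kill criterion for a RATE ratchet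
(`WakeRatchetDSS.blockRatio_le_of_rateContraction`: a rate-`a` tail contraction along such a solution forces
`ϱ ≤ ((1+ε₀)^{−a})^p`) then fires for EVERY `a > 1` with NO speed hypothesis at all, because
`((1+ε₀)^{−a})^p < ((1+ε₀)^{−1})^p`.  Consequently

* `EternalViscousRate_false_of_ViscousBlockDSSWaves : ViscousBlockDSSWaves → ¬ EternalViscousRate`,
* `TailRateRatchet_false_of_ViscousBlockDSSWaves  : ViscousBlockDSSWaves → ¬ TailRateRatchet`,

where `ViscousBlockDSSWaves` (the hypothesis H) is the bare EXISTENCE, on some class E₂(R) at arbitrarily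
small scale ratios, of a non-trivial uniformly bounded admissible eternal solution with positive covariant
viscosity that is block-self-similar with some shell period `p ≥ 1` and SOME lag — a dissipation-balanced,
discretely self-similar, type-I blow-up profile of the viscous model lattice.

WHY H IS NOT CONSTRUCTED HERE.  No exactly self-similar blow-up profile with finite shell action of a viscous
(or inviscid) Tao / dyadic cascade is in print: Tao's blow-up (arXiv:1402.0290, Thm. 1.4 / §4 Thm. 4.2) is
built by induction on scales and is not exactly self-similar (its dissipated fraction per shell tends to 0,
whereas an H-profile dissipates exactly the fraction `1 − (1+ε₀)^{−p}` of its energy per block); the only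
printed exactly self-similar dyadic solutions are the separable post-blow-up family `a_j/(t − t₀)` of
Barbato–Flandoli–Morandin and Jeong (arXiv:1705.01456, Thm. 1 and the theorem before it, p. 3), which the
action clause of `IsEternalVisc` excludes; and on the scalar dyadic member with Navier–Stokes-strength
dissipation blow-up itself is excluded for `λ = 2^{5/2}` and non-negative data (Barbato–Morandin–Romito 2011,
as quoted in arXiv:1402.0290 §1.2 p. 9 — an argument «sensitive to the specific numerical value of λ», hence
silent as `ε₀ → 0`).  So H is OPEN and this file changes no verdict.  What it tells a prover of 25647 /
25584: the route's dissipation mechanism (B) («a definite fraction is dissipated per shell ⇒ strict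
contraction») delivers AT MOST the a = 1 rate on exact profiles; a rate `a > 1` for `ν̂ > 0` is exactly the
non-existence of dissipation-balanced DSS profiles below the threshold (a Liouville statement), not a
retention estimate.

HONEST FRAMING: MODEL lattice ODEs only (Tao 2016 §4, §6.4); nothing here is a statement about the
Navier–Stokes equations, and no summit statement is proved or refuted.
-/

noncomputable section

set_option linter.dupNamespace false

namespace Summit.NavierStokesRegularity.NavierStokesRegularity.Theorems

namespace WakeRatchetViscDSS

open Literature.Analysis.FluidPDE Literature.Analysis.FluidPDE.TaoCascade
open Summit.NavierStokesRegularity.NavierStokesRegularity.Theses.WakeRatchet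

variable {m : ℕ} {ε₀ νh : ℝ} {α : Fin m → Fin m → Fin m → ℤ × ℤ × ℤ → ℝ} {W : ℤ → ℝ → Em m}

/-- **Lag pinning.**  A block-self-similar admissible eternal solution `W_{n+p}(σ) = W_n(σ − T)` of the
renormalised lattice with POSITIVE covariant viscosity that does not vanish identically has
`e^{T} = ((1+ε₀)^2)^p`: comparing the law of shell `n + p` at `σ₀` with the transported law of shell `n` at
`σ₀ − T` (same trajectory, `HasDerivAt.unique`) leaves `ν̂[(1+ε₀)^{2(n+p)}e^{−σ₀} − (1+ε₀)^{2n}e^{−(σ₀−T)}]·W = 0`.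
[cite: Tao2016AveragedNS, §4, the viscous equation before Thm. 4.2, in the self-similar variables of §6.4; elementary] -/
theorem viscBlockDSS_lag (hε : -1 < ε₀) (hν : 0 < νh) (hW : IsEternalVisc ε₀ νh α W) {p : ℕ} {T : ℝ}
    (hD : ∀ (n : ℤ) (σ : ℝ), W (n + p) σ = W n (σ - T)) {n₀ : ℤ} {σ₀ : ℝ} (hne : W n₀ σ₀ ≠ 0) :
    Real.exp T = ((1 + ε₀) ^ 2) ^ p := by
  have hb : 0 < 1 + ε₀ := by linarith
  obtain ⟨n, rfl⟩ : ∃ n : ℤ, n₀ = n + p := ⟨n₀ - p, by ring⟩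
  -- the two descriptions of the trajectory of shell `n + p`
  have hfun : (fun σ => W n (σ - T)) = W (n + p) := (funext (hD n)).symm
  have h1 := hW.law (n + p) σ₀
  have h2 : HasDerivAt (W (n + p))
      (-((1 : ℝ) • W n (σ₀ - T)) + tableQ α (W n (σ₀ - T))
        + bigLam ε₀ • tableA α (W (n - 1) (σ₀ - T))
        + (bigLam ε₀)⁻¹ • tableB α (W (n + 1) (σ₀ - T)) (W n (σ₀ - T))
        - (νh * ((1 + ε₀) ^ ((2 : ℝ) * n) * Real.exp (-(σ₀ - T)))) • W n (σ₀ - T)) σ₀ := by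
    rw [← hfun]
    exact HasDerivAt.comp_sub_const σ₀ T (hW.law n (σ₀ - T))
  have hEq := h1.unique h2
  -- rewrite the neighbours of shell `n + p` through the block self-similarity
  have e1 : W (n + p - 1) σ₀ = W (n - 1) (σ₀ - T) := by
    rw [show n + (p : ℤ) - 1 = (n - 1) + p by ring]; exact hD (n - 1) σ₀
  have e2 : W (n + p + 1) σ₀ = W (n + 1) (σ₀ - T) := by
    rw [show n + (p : ℤ) + 1 = (n + 1) + p by ring]; exact hD (n + 1) σ₀
  have e0 : W (n + p) σ₀ = W n (σ₀ - T) := hD n σ₀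
  rw [e1, e2, e0] at hEq
  -- only the dissipation coefficients differ
  have hsm : (νh * ((1 + ε₀) ^ ((2 : ℝ) * n) * Real.exp (-(σ₀ - T)))
      - νh * ((1 + ε₀) ^ ((2 : ℝ) * ((n + p : ℤ) : ℝ)) * Real.exp (-σ₀))) • W n (σ₀ - T) = 0 := by
    linear_combination (norm := module) hEq
  have hv : W n (σ₀ - T) ≠ 0 := by rwa [← e0]
  have hc := (smul_eq_zero.mp hsm).resolve_right hv
  -- `νh (1+ε₀)^{2n} e^{-σ₀} e^{T} = νh (1+ε₀)^{2n} (1+ε₀)^{2p} e^{-σ₀}`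
  have hcast : (2 : ℝ) * ((n + p : ℤ) : ℝ) = 2 * (n : ℝ) + 2 * (p : ℝ) := by push_cast; ring
  rw [hcast, Real.rpow_add hb, neg_sub, show T - σ₀ = -σ₀ + T by ring, Real.exp_add] at hc
  have hpos : 0 < νh * (1 + ε₀) ^ ((2 : ℝ) * n) * Real.exp (-σ₀) := by positivity
  have h3 : νh * (1 + ε₀) ^ ((2 : ℝ) * n) * Real.exp (-σ₀) * Real.exp T
      = νh * (1 + ε₀) ^ ((2 : ℝ) * n) * Real.exp (-σ₀) * (1 + ε₀) ^ ((2 : ℝ) * (p : ℝ)) := by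
    linear_combination hc
  have h4 : Real.exp T = (1 + ε₀) ^ ((2 : ℝ) * (p : ℝ)) := mul_left_cancel₀ hpos.ne' h3
  rw [h4, Real.rpow_mul hb.le, Real.rpow_natCast, Real.rpow_two]

/-- **Block ratio pinning.**  Under the hypotheses of `viscBlockDSS_lag` (and `ε₀ ≥ 0`) the block energy
ratio is the a = 1 rate: `e^{2T} Λ^{−2p} = ((1+ε₀)⁻¹)^p`.
[cite: Tao2016AveragedNS, §4 Lemma 4.1 (4.8)–(4.10) with the viscous equation before Thm. 4.2, §6.4; elementary] -/
theorem viscBlockDSS_ratio (hε : 0 ≤ ε₀) (hν : 0 < νh) (hW : IsEternalVisc ε₀ νh α W) {p : ℕ} {T : ℝ}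
    (hD : ∀ (n : ℤ) (σ : ℝ), W (n + p) σ = W n (σ - T)) {n₀ : ℤ} {σ₀ : ℝ} (hne : W n₀ σ₀ ≠ 0) :
    Real.exp (2 * T) * (bigLam ε₀ ^ p)⁻¹ ^ 2 = ((1 + ε₀)⁻¹) ^ p := by
  have hb : 0 < 1 + ε₀ := by linarith
  have hT := viscBlockDSS_lag (by linarith) hν hW hD hne
  have e1 : Real.exp (2 * T) = ((1 + ε₀) ^ 4) ^ p := by
    rw [show 2 * T = T + T by ring, Real.exp_add, hT, ← mul_pow]
    congr 1
    ring
  have e2 : (bigLam ε₀ ^ p)⁻¹ ^ 2 = (((1 + ε₀) ^ 5) ^ p)⁻¹ := by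
    rw [← bigLam_sq hε, inv_pow, ← pow_mul, ← pow_mul, mul_comm]
  rw [e1, e2, ← div_eq_mul_inv, ← div_pow]
  congr 1
  field_simp

/-- **H = `ViscousBlockDSSWaves`** (dissipation-balanced discretely self-similar blow-up profiles of the
viscous model lattice): on some table class E₂(R), at arbitrarily small scale ratios, there is a NON-TRIVIAL
uniformly bounded admissible eternal solution of the renormalised lattice with POSITIVE covariant viscosity
that is block-self-similar, `W_{n+p}(σ) = W_n(σ − T)`, for some shell period `p ≥ 1` and some lag `T` (then
necessarily `e^{T} = (1+ε₀)^{2p}`, `viscBlockDSS_lag`).  An existence statement quoted as a HYPOTHESIS;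
its status is open (see the module docstring); nothing is asserted.
[cite: Tao2016AveragedNS, §4, the viscous equation before Thm. 4.2, §6.4; cell vocabulary] -/
@[conjecture] def ViscousBlockDSSWaves : Prop :=
  ∃ R : ℝ, 1 ≤ R ∧ ∀ ε : ℝ, 0 < ε → ∃ ε₀ : ℝ, 0 < ε₀ ∧ ε₀ ≤ ε ∧
    ∃ α : Fin 4 → Fin 4 → Fin 4 → ℤ × ℤ × ℤ → ℝ, InTableClass R α ∧
      ∃ (νh : ℝ) (W : ℤ → ℝ → Em 4) (p : ℕ) (T : ℝ), 0 < νh ∧ 0 < p ∧ IsEternalVisc ε₀ νh α W ∧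
        UniformBound W ∧ (∀ (n : ℤ) (σ : ℝ), W (n + p) σ = W n (σ - T)) ∧ ∃ n σ, W n σ ≠ 0

/-- The core contradiction: a rate-`a` tail contraction, `a > 1`, CANNOT hold along a non-trivial uniformly
bounded block-self-similar admissible eternal solution with positive covariant viscosity (its block ratio is
the a = 1 rate, `viscBlockDSS_ratio`, while the contraction forces a ratio `≤ ((1+ε₀)^{−a})^p`,
`WakeRatchetDSS.blockRatio_le_of_rateContraction`).
[cite: Tao2016AveragedNS, §4 Lemma 4.1 (4.8)–(4.10) with the viscous equation before Thm. 4.2, §6.4; cell vocabulary] -/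
theorem not_rateContraction_of_viscBlockDSS (hε : 0 < ε₀) (hν : 0 < νh) {a : ℝ} (ha : 1 < a)
    (hc : IsCancellingCoeff α) (hW : IsEternalVisc ε₀ νh α W) (hU : UniformBound W) {p : ℕ} (hp : 0 < p)
    {T : ℝ} (hD : ∀ (n : ℤ) (σ : ℝ), W (n + p) σ = W n (σ - T)) {n₀ : ℤ} {σ₀ : ℝ} (hne : W n₀ σ₀ ≠ 0) :
    ¬ ∀ (n : ℤ) (M : ℝ), (∀ σ : ℝ, ∑' k : ℕ, physEnergy ε₀ W (n + k) σ ≤ M) →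
      ∀ σ : ℝ, ∑' k : ℕ, physEnergy ε₀ W (n + 1 + k) σ ≤ (1 + ε₀) ^ (-a) * M := by
  intro hRate
  have h1 := WakeRatchetDSS.blockRatio_le_of_rateContraction hε hc hW hU hD hRate hne
  rw [viscBlockDSS_ratio hε.le hν hW hD hne] at h1
  have hb1 : 1 < 1 + ε₀ := by linarith
  have hlt : (1 + ε₀) ^ (-a) < (1 + ε₀)⁻¹ := by
    rw [← Real.rpow_neg_one]
    exact Real.rpow_lt_rpow_of_exponent_lt hb1 (by linarith)
  have h2 : ((1 + ε₀) ^ (-a)) ^ p < ((1 + ε₀)⁻¹) ^ p :=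
    pow_lt_pow_left₀ hlt (Real.rpow_nonneg (by linarith) _) hp.ne'
  exact absurd h1 (not_le.mpr h2)

/-- **Negative lemma (stmt-NavierStokesRegularity-25647): `ViscousBlockDSSWaves → ¬ EternalViscousRate`.**
The viscous rate ratchet binds every `ν̂ > 0`, every E₂(R) table below its threshold `εs(R)` and every
uniformly bounded admissible eternal solution; H supplies, at a scale ratio `ε₀ ≤ εs(R)`, a block-self-similar
one, along which no rate `a > 1` can hold (`not_rateContraction_of_viscBlockDSS`).
[cite: Tao2016AveragedNS, §4, §6.4; cell vocabulary (stmt-NavierStokesRegularity-25647)] -/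
theorem EternalViscousRate_false_of_ViscousBlockDSSWaves :
    ViscousBlockDSSWaves →
      ¬ Summit.NavierStokesRegularity.NavierStokesRegularity.Theses.WakeRatchet.EternalViscousRate := by
  rintro ⟨R, hR, hF⟩ hS
  obtain ⟨a, ha, εs, hεs, H⟩ := hS R hR
  obtain ⟨ε₀, hε₀, hle, α, hα, νh, W, p, T, hν, hp, hW, hU, hD, n₀, σ₀, hne⟩ := hF εs hεs
  exact not_rateContraction_of_viscBlockDSS hε₀ hν ha hα.2.1 hW hU hp hD hne
    (H ε₀ hε₀ hle α hα νh W hν hW hU)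

/-- **Negative lemma (stmt-NavierStokesRegularity-25584): `ViscousBlockDSSWaves → ¬ TailRateRatchet`.**
The parent crux binds every covariant viscosity `ν̂ ≥ 0`, in particular the positive one carried by H.
[cite: Tao2016AveragedNS, §4, §6.4; cell vocabulary (stmt-NavierStokesRegularity-25584)] -/
theorem TailRateRatchet_false_of_ViscousBlockDSSWaves :
    ViscousBlockDSSWaves →
      ¬ Summit.NavierStokesRegularity.NavierStokesRegularity.Theses.WakeRatchet.TailRateRatchet := by
  rintro ⟨R, hR, hF⟩ hS
  obtain ⟨a, ha, εs, hεs, H⟩ := hS R hR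
  obtain ⟨ε₀, hε₀, hle, α, hα, νh, W, p, T, hν, hp, hW, hU, hD, n₀, σ₀, hne⟩ := hF εs hεs
  exact not_rateContraction_of_viscBlockDSS hε₀ hν ha hα.2.1 hW hU hp hD hne
    (H ε₀ hε₀ hle α hα νh W hW hU)

end WakeRatchetViscDSS

end Summit.NavierStokesRegularity.NavierStokesRegularity.Theorems

end
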